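import Literature.NumberTheory.PAdicHodge.KummerFilZeroCoboundaryCriterion
import Literature.NumberTheory.PAdicHodge.NeronDeRhamDatumOfDeRham
import HarnessLib

/-!
# The period determinant is `F^× · t`: Legendre transversality and Tate's Hodge–Tate nonvanishing from the WEIL determinant

Topic `Literature/NumberTheory/PAdicHodge`; §1 extends the tree structure `PeriodRingData` (namespace
`Literature.NumberTheory.GaloisRepresentations.PeriodRingData`), §2–§3 live in `Literature.NumberTheory.PAdicHodge`. THEOREMS ONLY
(no definition, no named fact, no instance, no `sorry`).

The tree's Legendre transversality `det_not_mem_fil_two_of_periodHoms` (file `BdRPeriodDeterminantTransversal`) and the basis-free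
`Fil⁰`-coboundary criterion `isFilZeroCoboundary_restrictedRationalTateRep_of_periodHoms` (file `KummerFilZeroCoboundaryCriterion`) take
as an INPUT Tate's theorem «the Hodge–Tate map is nonzero»: `∃ m, φ₁ m ∉ Fil² B_dR` for the `ω`-period `φ₁ = ∫ω`. The tree discharges it
only for `ℤ`-models with good supersingular reduction and `p ≥ 5` (`AinfWeierstrassHodgeTateNonvanishing`, a tilt argument that does
not survive over a ramified base). Here it is DERIVED, for every two-dimensional representation whose determinant is the cyclotomic
character, from what the tree already proves — Fontaine's regularity `B_dR(F)^{Γ_F} = F` (`bdRPeriodRingData.invariants_eq`, resting on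
TATE's `ℂ_F(χ^j)^{Γ_F} = 0`), `σ t = χ(σ) t` (`smul_tFrac`) and the Weil determinant `det ρ_{E,p} = χ`
(`det_restrictedRationalTateRep_eq_cyclotomicCharacter`, from `det_galoisRepTate_eq_cyclotomicCharacter_holds`):

* §1 (abstract datum `𝔅`, representation `ρ` on `V` with basis `v`, equivariant functionals `Φᵢ`): the PERIOD MATRIX
  `H = (Φᵢ(v_j))` has `σ(det H) = det R(σ) · det H` (`smul_det_periodMatrix`), `det H ≠ 0` when the `Φᵢ` are `E`-linearly
  independent (`det_periodMatrix_ne_zero`), and **`det H = e · t` with `e ∈ E`** for any nonzero `t ∈ B` with `σ t = det R(σ) · t`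
  (`exists_det_periodMatrix_eq_smul`, regularity (ii)).
* §2 (`𝔅 = B_dR(F)`, `dim V = 2`, `det ρ(σ) = χ(σ)`): **`Δ = φ₁(v₀)φ₂(v₁) − φ₁(v₁)φ₂(v₀) = c · t` with `c ∈ F^×`**
  (`exists_det_eq_algebraMap_mul_tFrac`) as soon as `φ₁ ≠ 0` takes values in `Fil¹` and `φ₂` misses `Fil¹` somewhere; hence
  **`Δ ∉ Fil²`** (`det_not_mem_fil_two_of_det_eq_cyclotomic` — Legendre transversality WITHOUT the Hodge–Tate hypothesis) and, when
  `φ₂ ⊆ B_dR⁺`, **`∃ m, φ₁ m ∉ Fil²`** (`exists_apply_not_mem_fil_two_of_det_eq_cyclotomic` — TATE'S Hodge–Tate nonvanishing).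
* §3 (elliptic curves; `det (V_pW|_{Γ_F})(σ) = χ_F(σ)` is the tree's `det_restrictedRationalTateRep_eq_cyclotomicCharacter`): for two additive
  `ℤ_p`-homogeneous `Γ_F`-equivariant period maps `φ₁ ⊆ Fil¹` (`≢ 0`), `φ₂ ⊆ B_dR⁺` (`⊄ Fil¹`) on `T_pW`:
  **`exists_not_mem_fil_two_restrictedRationalTateRep_of_periodHoms`** (`∃ a, φ₁ a ∉ Fil²`) and the `Fil⁰`-coboundary criterion with
  the Hodge–Tate hypothesis REPLACED by `φ₁ ≢ 0`: **`isFilZeroCoboundary_restrictedRationalTateRep_of_periodHoms_of_ne_zero`**.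

Use: brick K1 of the hT₂ programme of crux K★ `stmt-BirchSwinnertonDyer-22226` over the RAMIFIED base (`KummerFilZeroCoboundaryRamified`,
whose hypothesis (HT) this file discharges from (N1′) `∫ω ≢ 0`). BSD / K★ are not proved by any of this.

## References
* [Tate1967] J. Tate, *p-divisible groups* (1967), §3.3 Thm. 2 (`ℂ(χ^j)^Γ = 0`), §4 Cor. 2 (the Hodge–Tate map is nonzero).
* [Fontaine1982FormesDifferentielles] J.-M. Fontaine, Invent. Math. 65 (1982), §5 (the period pairing; `Λ² V_pA` and `t`).
* [Colmez1992PeriodesAbeliennes] P. Colmez, Math. Ann. 292 (1992), §2 (the `p`-adic Legendre relation `∫ω∫η′ − ∫η∫ω′ ∈ ℚ_p^× · t`).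
* [FontaineAsterisque223III] J.-M. Fontaine, Astérisque 223 (1994), Exp. II §1.5.5–1.5.7, Exp. III §1.4–1.5.
* [SilvermanAEC2009] J. H. Silverman, *AEC* (2009), Prop. III.8.3 (`det ρ_ℓ = χ_ℓ` via the Weil pairing).
-/

noncomputable section

open Matrix
open scoped TensorProduct

/-! ## §1 The determinant of a period matrix -/

namespace Literature.NumberTheory.GaloisRepresentations.PeriodRingData

section PeriodMatrix

-- Mathlib's own global value of `maxSynthPendingDepth` (see `PeriodRingData.finrank_D_le_holds`).
set_option maxSynthPendingDepth 3

universe u v v' w w'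

variable {Γ : Type u} [Group Γ] [TopologicalSpace Γ] {P : Type v} {E : Type v'} [Field P]
  [TopologicalSpace P] [Field E] [Algebra P E]
  {M : Type w'} [AddCommGroup M] [Module P M] [TopologicalSpace M]
  (𝔅 : PeriodRingData.{u, v, v', w} Γ P E) (ρ : ContinuousRep Γ P M)

/-- **Transformation law of the period determinant**: for equivariant functionals `Φᵢ` and a basis `v`, the period matrix
`H = (Φᵢ(v_j))` satisfies `σ(H) = H · R(σ)`, hence `σ(det H) = det R(σ) · det H` (`R(σ)` the matrix of `ρ(σ)` in `v`).
[cite: FontaineAsterisque223III, Exp. III §1.5] -/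
theorem smul_det_periodMatrix {ι : Type*} [Fintype ι] [DecidableEq ι] (v : Module.Basis ι P M)
    {Φ : ι → (M →ₗ[P] 𝔅.B)} (hΦ : ∀ i σ m, Φ i (ρ σ m) = σ • Φ i m) (σ : Γ) :
    σ • (Matrix.of fun i j => Φ i (v j)).det =
      algebraMap P 𝔅.B (LinearMap.toMatrix v v (ρ σ)).det * (Matrix.of fun i j => Φ i (v j)).det := by
  let g : 𝔅.B →+* 𝔅.B := MulSemiringAction.toRingHom Γ 𝔅.B σ
  have hσH : g.mapMatrix (Matrix.of fun i j => Φ i (v j)) =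
      (Matrix.of fun i j => Φ i (v j)) * (LinearMap.toMatrix v v (ρ σ)).map (algebraMap P 𝔅.B) := by
    ext i j
    rw [RingHom.mapMatrix_apply, Matrix.map_apply, Matrix.mul_apply]
    simp only [Matrix.of_apply, Matrix.map_apply, g, MulSemiringAction.toRingHom_apply]
    exact 𝔅.smul_apply_basis_of_equivariant ρ v (hΦ i) σ j
  have h1 : σ • (Matrix.of fun i j => Φ i (v j)).det = g (Matrix.of fun i j => Φ i (v j)).det := rfl
  rw [h1, RingHom.map_det, hσH, Matrix.det_mul, ← RingHom.mapMatrix_apply, ← RingHom.map_det, mul_comm]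

/-- **The period determinant of `E`-linearly independent equivariant functionals is nonzero** (injectivity of Fontaine's
comparison map: `E`-independent ⇒ `B`-independent, `linearIndependent_of_equivariant`; a vanishing determinant would give a
`B`-relation among the rows `Φᵢ ∘ v`). [cite: FontaineAsterisque223III, Exp. III Prop. 1.4.2 and Thm. 1.5.2] -/
theorem det_periodMatrix_ne_zero {ι : Type*} [Fintype ι] [DecidableEq ι] (v : Module.Basis ι P M)
    {Φ : ι → (M →ₗ[P] 𝔅.B)} (hΦ : ∀ i σ m, Φ i (ρ σ m) = σ • Φ i m) (hli : LinearIndependent E Φ) :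
    (Matrix.of fun i j => Φ i (v j)).det ≠ 0 := by
  have hliB : LinearIndependent 𝔅.B Φ := 𝔅.linearIndependent_of_equivariant ρ hΦ hli
  intro h0
  obtain ⟨c, hc0, hc⟩ := Matrix.exists_vecMul_eq_zero_iff.2 h0
  have hrel : ∑ i, c i • Φ i = 0 := by
    refine v.ext fun j => ?_
    have hj : ∑ i, c i * (Matrix.of fun i j => Φ i (v j)) i j = 0 := by
      have h := congrFun hc j
      simpa only [Matrix.vecMul, dotProduct, Pi.zero_apply] using h
    simpa only [LinearMap.coe_sum, Finset.sum_apply, LinearMap.smul_apply, smul_eq_mul, LinearMap.zero_apply,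
      Matrix.of_apply] using hj
  exact hc0 (funext fun i => Fintype.linearIndependent_iff.1 hliB c hrel i)

/-- **Galois descent of the period determinant**: if `t ∈ B` is nonzero with `σ t = det R(σ) · t` for all `σ` (for
`det ρ = χ` the cyclotomic character: Fontaine's `t`), then `det H = e · t` for some `e ∈ E = B^Γ` (regularity (ii):
`det H / t` is `Γ`-invariant). [cite: FontaineAsterisque223III, Exp. III §1.4] [cite: Fontaine1982FormesDifferentielles, §5] -/
theorem exists_det_periodMatrix_eq_smul {ι : Type*} [Fintype ι] [DecidableEq ι] (v : Module.Basis ι P M)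
    {Φ : ι → (M →ₗ[P] 𝔅.B)} (hΦ : ∀ i σ m, Φ i (ρ σ m) = σ • Φ i m) {t : 𝔅.B} (ht : t ≠ 0)
    (hσt : ∀ σ : Γ, σ • t = algebraMap P 𝔅.B (LinearMap.toMatrix v v (ρ σ)).det * t) :
    ∃ e : E, (Matrix.of fun i j => Φ i (v j)).det = e • t :=
  𝔅.exists_smul_eq _ t ht fun σ => by
    rw [𝔅.smul_det_periodMatrix ρ v hΦ σ, hσt σ]
    ring

end PeriodMatrix

end Literature.NumberTheory.GaloisRepresentations.PeriodRingData

/-! ## §2 `B_dR(F)`: the period determinant of a representation with cyclotomic determinant is `F^× · t` -/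

namespace Literature.NumberTheory.PAdicHodge

open Literature Literature.NumberTheory.GaloisRepresentations Literature.NumberTheory.EllipticCurves WeierstrassCurve
open Literature.NumberTheory.GaloisRepresentations.IsNonarchimedeanLocalField Field ValuativeRel WittVector

variable {F : Type} [Field F] [ValuativeRel F] [TopologicalSpace F] [IsNonarchimedeanLocalField F] [CharZero F]
  {p : ℕ} [Fact p.Prime] [Fact (¬ IsUnit (p : integerC F))] [IsAdicComplete (Ideal.span {(p : integerC F)}) (integerC F)]
  (hp : valuation F p < 1) [Algebra ℚ_[p] F]

/-- The scalar `χ(σ) ∈ ℚ_p ⊆ B_dR(F)` of the datum is Fontaine's `chiFrac σ` (canonical `ℚ_p`-structure on `F`; plumbing twin of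
`algebraMap_chi_bdRPeriodRingData`). [folklore] -/
private theorem algebraMap_cyclotomicCharacter_bdRPeriodRingData
    (halg : ∀ c : ℚ_[p], algebraMap ℚ_[p] F c = LocalField.padicRingHom F p hp c) (σ : absoluteGaloisGroup F) :
    algebraMap ℚ_[p] (bdRPeriodRingData (F := F) (p := p) hp).B
        (((GaloisRep.cyclotomicCharacter F p σ : ℤ_[p]ˣ) : ℤ_[p]) : ℚ_[p]) = (chiFrac σ : FracBdR F p) := by
  rw [PeriodRingData.algebraMap_eq, algebraMap_bdRPeriodRingData (surjective_fontaineTheta_integerC hp) hp,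
    embBdRHom_algebraMap_padic hp (surjective_fontaineTheta_integerC hp) halg]
  rfl

/-- **The period determinant is `F^× · t`.** `ρ` on `V` (basis `v₀, v₁`) with `det ρ(σ) = χ(σ)`, `φ₁, φ₂ : V → B_dR(F)` `ℚ_p`-linear
and `Γ_F`-equivariant, `φ₁ ≠ 0` with values in `Fil¹`, `φ₂(m₂) ∉ Fil¹` for some `m₂`. Then
`φ₁(v₀)φ₂(v₁) − φ₁(v₁)φ₂(v₀) = c · t` for some `c ∈ F^×` — the valuation content of the `p`-adic Legendre relation, by Galois descent:
`σΔ = det ρ(σ) Δ = χ(σ)Δ`, `σt = χ(σ)t`, `B_dR^{Γ_F} = F`, and `Δ ≠ 0` since `φ₁, φ₂` are `F`-, hence `B_dR`-, linearly independent.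
[cite: Fontaine1982FormesDifferentielles, §5] [cite: Colmez1992PeriodesAbeliennes, §2] [cite: FontaineAsterisque223III, Exp. III §1.5] -/
theorem exists_det_eq_algebraMap_mul_tFrac {M : Type} [AddCommGroup M] [Module ℚ_[p] M] [TopologicalSpace M]
    (ρ : ContinuousRep (absoluteGaloisGroup F) ℚ_[p] M) (v : Module.Basis (Fin 2) ℚ_[p] M)
    (hdet : ∀ σ, LinearMap.det (ρ σ : M →ₗ[ℚ_[p]] M) = (((GaloisRep.cyclotomicCharacter F p σ : ℤ_[p]ˣ) : ℤ_[p]) : ℚ_[p]))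
    (halg : ∀ c : ℚ_[p], algebraMap ℚ_[p] F c = LocalField.padicRingHom F p hp c)
    (φ₁ φ₂ : M →ₗ[ℚ_[p]] (bdRPeriodRingData (F := F) (p := p) hp).B)
    (h₁ : ∀ σ m, φ₁ (ρ σ m) = σ • φ₁ m) (h₂ : ∀ σ m, φ₂ (ρ σ m) = σ • φ₂ m)
    (hfil₁ : ∀ m, φ₁ m ∈ (bdRPeriodRingData (F := F) (p := p) hp).fil 1)
    (hne : ∃ m, φ₁ m ≠ 0) (hnot : ∃ m, φ₂ m ∉ (bdRPeriodRingData (F := F) (p := p) hp).fil 1) :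
    ∃ c : F, c ≠ 0 ∧ φ₁ (v 0) * φ₂ (v 1) - φ₁ (v 1) * φ₂ (v 0) =
      algebraMap F (bdRPeriodRingData (F := F) (p := p) hp).B c *
        (show (bdRPeriodRingData (F := F) (p := p) hp).B from (tFrac : FracBdR F p)) := by
  classical
  have hF := surjective_fontaineTheta_integerC hp
  -- the period matrix of `(φ₁, φ₂)` in `v` and its determinant
  have hΦ : ∀ (i : Fin 2) σ m, (![φ₁, φ₂] i) (ρ σ m) = σ • (![φ₁, φ₂] i) m := fun i σ m => by
    fin_cases i <;> simp [h₁ σ m, h₂ σ m]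
  have hdetH : (Matrix.of fun i j => (![φ₁, φ₂] i) (v j)).det = φ₁ (v 0) * φ₂ (v 1) - φ₁ (v 1) * φ₂ (v 0) := by
    rw [Matrix.det_fin_two]
    simp only [Matrix.of_apply, Matrix.cons_val_zero, Matrix.cons_val_one]
  -- `Δ ≠ 0`
  have hne' : φ₁ ≠ 0 := by
    obtain ⟨m, hm⟩ := hne
    exact fun h0 => hm (by rw [h0, LinearMap.zero_apply])
  have hli : LinearIndependent F ![φ₁, φ₂] :=
    (bdRPeriodRingData (F := F) (p := p) hp).linearIndependent_pair_of_fil hfil₁ hne' hnot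
  have hdet0 := (bdRPeriodRingData (F := F) (p := p) hp).det_periodMatrix_ne_zero ρ v hΦ hli
  -- `σ t = det ρ(σ) · t`
  have htne : (tFrac : FracBdR F p) ≠ 0 := tFrac_ne_zero hF
  have hσt : ∀ σ : absoluteGaloisGroup F, σ • (show (bdRPeriodRingData (F := F) (p := p) hp).B from (tFrac : FracBdR F p)) =
      algebraMap ℚ_[p] (bdRPeriodRingData (F := F) (p := p) hp).B (LinearMap.toMatrix v v (ρ σ)).det *
        (show (bdRPeriodRingData (F := F) (p := p) hp).B from (tFrac : FracBdR F p)) := fun σ => by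
    rw [LinearMap.det_toMatrix, hdet σ, algebraMap_cyclotomicCharacter_bdRPeriodRingData hp halg σ]
    exact smul_tFrac σ
  -- descent
  obtain ⟨c, hc⟩ := (bdRPeriodRingData (F := F) (p := p) hp).exists_det_periodMatrix_eq_smul ρ v hΦ htne hσt
  refine ⟨c, fun hc0 => hdet0 ?_, ?_⟩
  · rw [hc, hc0, zero_smul]
  · rw [← hdetH, hc, Algebra.smul_def]

/-- **Legendre transversality without the Hodge–Tate hypothesis.** Under the hypotheses of `exists_det_eq_algebraMap_mul_tFrac`
(`det ρ = χ`, `φ₁ ≠ 0` in `Fil¹`, `φ₂ ⊄ Fil¹`): `φ₁(v₀)φ₂(v₁) − φ₁(v₁)φ₂(v₀) ∉ Fil² B_dR` (`= c·t`, `c ∈ F^×`, `t = ξ · unit`).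
[cite: Colmez1992PeriodesAbeliennes, §2] [cite: Tate1967, §3.3 Thm. 2] -/
theorem det_not_mem_fil_two_of_det_eq_cyclotomic {M : Type} [AddCommGroup M] [Module ℚ_[p] M] [TopologicalSpace M]
    (ρ : ContinuousRep (absoluteGaloisGroup F) ℚ_[p] M) (v : Module.Basis (Fin 2) ℚ_[p] M)
    (hdet : ∀ σ, LinearMap.det (ρ σ : M →ₗ[ℚ_[p]] M) = (((GaloisRep.cyclotomicCharacter F p σ : ℤ_[p]ˣ) : ℤ_[p]) : ℚ_[p]))
    (halg : ∀ c : ℚ_[p], algebraMap ℚ_[p] F c = LocalField.padicRingHom F p hp c)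
    (φ₁ φ₂ : M →ₗ[ℚ_[p]] (bdRPeriodRingData (F := F) (p := p) hp).B)
    (h₁ : ∀ σ m, φ₁ (ρ σ m) = σ • φ₁ m) (h₂ : ∀ σ m, φ₂ (ρ σ m) = σ • φ₂ m)
    (hfil₁ : ∀ m, φ₁ m ∈ (bdRPeriodRingData (F := F) (p := p) hp).fil 1)
    (hne : ∃ m, φ₁ m ≠ 0) (hnot : ∃ m, φ₂ m ∉ (bdRPeriodRingData (F := F) (p := p) hp).fil 1) :
    φ₁ (v 0) * φ₂ (v 1) - φ₁ (v 1) * φ₂ (v 0) ∉ (bdRPeriodRingData (F := F) (p := p) hp).fil 2 := by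
  have hF := surjective_fontaineTheta_integerC hp
  haveI : IsDomain (BDeRhamPlus (integerC F) p) := isDomain_bDeRhamPlus hF
  letI : Algebra F (FracBdR F p) := fracAlgebra hp hF
  let alg : BDeRhamPlus (integerC F) p →+* FracBdR F p := algebraMap (BDeRhamPlus (integerC F) p) (FracBdR F p)
  have halgi : Function.Injective alg := algebraMap_fracBdR_injective
  have mem_fil : ∀ (i : ℤ) (x : (bdRPeriodRingData (F := F) (p := p) hp).B),
      x ∈ (bdRPeriodRingData (F := F) (p := p) hp).fil i ↔ ∃ b : BDeRhamPlus (integerC F) p, x = alg xiBdR ^ i * alg b :=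
    fun i x => mem_fil_iff hp hF
  obtain ⟨c, hc0, hΔ⟩ := exists_det_eq_algebraMap_mul_tFrac hp ρ v hdet halg φ₁ φ₂ h₁ h₂ hfil₁ hne hnot
  obtain ⟨w, hw, htw⟩ := exists_tBdR_eq_xiBdR_mul (F := F) (p := p) hF
  have hξ0 : (xiBdR : BDeRhamPlus (integerC F) p) ≠ 0 := fun h =>
    algebraMap_xiBdR_ne_zero (F := F) (p := p) hF (by rw [h, map_zero])
  intro hmem
  obtain ⟨d, hd⟩ := (mem_fil 2 _).1 hmem
  rw [hΔ] at hd
  -- `Δ = alg (e · ξ · w)` with `e = embBdRHom c`, versus `Δ = alg (ξ² d)`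
  have hΔ' : algebraMap F (bdRPeriodRingData (F := F) (p := p) hp).B c *
      (show (bdRPeriodRingData (F := F) (p := p) hp).B from (tFrac : FracBdR F p)) =
      alg (embBdRHom hp hF c * xiBdR * w) := by
    rw [mul_assoc, ← htw, map_mul]; rfl
  have h2 : alg xiBdR ^ (2 : ℤ) * alg d = alg (xiBdR * (xiBdR * d)) := by
    rw [show (2 : ℤ) = ((2 : ℕ) : ℤ) from rfl, zpow_natCast, map_mul, map_mul, pow_two, mul_assoc]
  rw [hΔ', h2] at hd
  have hd' : embBdRHom hp hF c * w * xiBdR = xiBdR * d * xiBdR := by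
    have := halgi hd
    calc embBdRHom hp hF c * w * xiBdR = embBdRHom hp hF c * xiBdR * w := by ring
      _ = xiBdR * (xiBdR * d) := this
      _ = xiBdR * d * xiBdR := by ring
  have hd'' := mul_right_cancel₀ hξ0 hd'
  -- apply `θ`: `θ(e) θ(w) = θ(ξ) θ(d) = 0` with `θ(w) ≠ 0`, `θ(e) = c ≠ 0`
  have hθ := congrArg thetaBdR hd''
  rw [map_mul, thetaBdR_embBdRHom, map_mul, thetaBdR_xiBdR, zero_mul] at hθ
  rcases mul_eq_zero.1 hθ with h | h
  · exact hc0 ((map_eq_zero_iff _ (algebraMap F (CompletedAlgClosure F)).injective).1 h)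
  · exact ((isUnit_iff_thetaBdR_ne_zero hF _).1 hw) h

/-- **Tate's theorem «the Hodge–Tate map is nonzero», from the Weil determinant.** Under the hypotheses of
`det_not_mem_fil_two_of_det_eq_cyclotomic` and `φ₂ ⊆ Fil⁰ = B_dR⁺`: `φ₁(m) ∉ Fil² B_dR` for some `m` (otherwise the period determinant
would lie in `Fil² · Fil⁰ ⊆ Fil²`). For `φ₁ = ∫ω`, `φ₂ = ∫η` on `T_pE`: the Hodge–Tate component `[τ] mod Fil²` of some Tate-module
point is nonzero. [cite: Tate1967, §4 Cor. 2] [cite: Fontaine1982FormesDifferentielles, §5] -/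
theorem exists_apply_not_mem_fil_two_of_det_eq_cyclotomic {M : Type} [AddCommGroup M] [Module ℚ_[p] M] [TopologicalSpace M]
    (ρ : ContinuousRep (absoluteGaloisGroup F) ℚ_[p] M) (v : Module.Basis (Fin 2) ℚ_[p] M)
    (hdet : ∀ σ, LinearMap.det (ρ σ : M →ₗ[ℚ_[p]] M) = (((GaloisRep.cyclotomicCharacter F p σ : ℤ_[p]ˣ) : ℤ_[p]) : ℚ_[p]))
    (halg : ∀ c : ℚ_[p], algebraMap ℚ_[p] F c = LocalField.padicRingHom F p hp c)
    (φ₁ φ₂ : M →ₗ[ℚ_[p]] (bdRPeriodRingData (F := F) (p := p) hp).B)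
    (h₁ : ∀ σ m, φ₁ (ρ σ m) = σ • φ₁ m) (h₂ : ∀ σ m, φ₂ (ρ σ m) = σ • φ₂ m)
    (hfil₁ : ∀ m, φ₁ m ∈ (bdRPeriodRingData (F := F) (p := p) hp).fil 1)
    (hfil₂ : ∀ m, φ₂ m ∈ (bdRPeriodRingData (F := F) (p := p) hp).fil 0)
    (hne : ∃ m, φ₁ m ≠ 0) (hnot : ∃ m, φ₂ m ∉ (bdRPeriodRingData (F := F) (p := p) hp).fil 1) :
    ∃ m, φ₁ m ∉ (bdRPeriodRingData (F := F) (p := p) hp).fil 2 := by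
  by_contra hall
  push Not at hall
  apply det_not_mem_fil_two_of_det_eq_cyclotomic hp ρ v hdet halg φ₁ φ₂ h₁ h₂ hfil₁ hne hnot
  have hmul : ∀ i j, φ₁ (v i) * φ₂ (v j) ∈ (bdRPeriodRingData (F := F) (p := p) hp).fil 2 := fun i j => by
    have h := (bdRPeriodRingData (F := F) (p := p) hp).mul_mem_fil 2 0 _ _ (hall (v i)) (hfil₂ (v j))
    rwa [add_zero] at h
  exact sub_mem (hmul 0 1) (hmul 1 0)

/-! ## §3 Elliptic curves: the period maps on `T_pW` -/

section Generic

variable {A : Type} [AddCommGroup A] (ρ : GaloisRep F ℚ_[p] (RationalTateModule A p))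
  (act : absoluteGaloisGroup F → TateModule A p → TateModule A p)

/-- **Hodge–Tate nonvanishing for a `T_p`-lattice with two separated period maps and cyclotomic determinant.** `ρ` on the
`2`-dimensional `V_pA` induced by `act`, `det ρ(σ) = χ(σ)`, `φ₁ φ₂ : T_pA →+ B_dR(F)` additive, `ℤ_p`-homogeneous, `Γ_F`-equivariant,
`φ₁ ⊆ Fil¹` with `φ₁ ≢ 0`, `φ₂ ⊆ Fil⁰` with `φ₂ ⊄ Fil¹` ⟹ `φ₁(a) ∉ Fil²` for some `a ∈ T_pA`. [cite: Tate1967, §4 Cor. 2]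
[cite: Fontaine1982FormesDifferentielles, §5] -/
theorem exists_not_mem_fil_two_rationalTateModule_of_periodHoms [Module.Finite ℚ_[p] (RationalTateModule A p)]
    (h2 : Module.finrank ℚ_[p] (RationalTateModule A p) = 2)
    (hρ : ∀ (σ : absoluteGaloisGroup F) (c : ℚ_[p]) (a : TateModule A p),
      ρ σ ((c ⊗ₜ[ℤ_[p]] a : ℚ_[p] ⊗[ℤ_[p]] TateModule A p) : RationalTateModule A p) =
        ((c ⊗ₜ[ℤ_[p]] act σ a : ℚ_[p] ⊗[ℤ_[p]] TateModule A p) : RationalTateModule A p))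
    (hdet : ∀ σ, LinearMap.det (ρ σ : RationalTateModule A p →ₗ[ℚ_[p]] RationalTateModule A p) =
      (((GaloisRep.cyclotomicCharacter F p σ : ℤ_[p]ˣ) : ℤ_[p]) : ℚ_[p]))
    (φ₁ φ₂ : TateModule A p →+ (bdRPeriodRingData (F := F) (p := p) hp).B)
    (hφ₁ : ∀ (c : ℤ_[p]) (a : TateModule A p), φ₁ (c • a) = (c : ℚ_[p]) • φ₁ a)
    (hφ₂ : ∀ (c : ℤ_[p]) (a : TateModule A p), φ₂ (c • a) = (c : ℚ_[p]) • φ₂ a)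
    (hσ₁ : ∀ (σ : absoluteGaloisGroup F) (a : TateModule A p), φ₁ (act σ a) = σ • φ₁ a)
    (hσ₂ : ∀ (σ : absoluteGaloisGroup F) (a : TateModule A p), φ₂ (act σ a) = σ • φ₂ a)
    (hfil₁ : ∀ a, φ₁ a ∈ (bdRPeriodRingData (F := F) (p := p) hp).fil 1)
    (hfil₂ : ∀ a, φ₂ a ∈ (bdRPeriodRingData (F := F) (p := p) hp).fil 0)
    (hne : ∃ a, φ₁ a ≠ 0) (hnot : ∃ a, φ₂ a ∉ (bdRPeriodRingData (F := F) (p := p) hp).fil 1) :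
    ∃ a, φ₁ a ∉ (bdRPeriodRingData (F := F) (p := p) hp).fil 2 := by
  classical
  -- rigidity of the `ℚ_p`-algebra structure of `F`
  have halg : ∀ c : ℚ_[p], algebraMap ℚ_[p] F c = LocalField.padicRingHom F p hp c := fun c =>
    RingHom.congr_fun (LocalField.ringHom_padic_ext _ _) c
  let v : Module.Basis (Fin 2) ℚ_[p] (RationalTateModule A p) := Module.finBasisOfFinrankEq ℚ_[p] _ h2
  obtain ⟨Φ₁, hΦ₁, hΦ₁σ⟩ := exists_equivariant_extend_rationalTateModule (bdRPeriodRingData (F := F) (p := p) hp) ρ act hρ φ₁ hφ₁ hσ₁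
  obtain ⟨Φ₂, hΦ₂, hΦ₂σ⟩ := exists_equivariant_extend_rationalTateModule (bdRPeriodRingData (F := F) (p := p) hp) ρ act hρ φ₂ hφ₂ hσ₂
  obtain ⟨a₁, ha₁⟩ := hne
  obtain ⟨a₂, ha₂⟩ := hnot
  by_contra hall
  push Not at hall
  obtain ⟨m, hm⟩ := exists_apply_not_mem_fil_two_of_det_eq_cyclotomic hp ρ v hdet halg Φ₁ Φ₂ hΦ₁σ hΦ₂σ
    (apply_mem_of_forall_toRational_mem _ Φ₁ _ fun a => by rw [hΦ₁]; exact hfil₁ a)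
    (apply_mem_of_forall_toRational_mem _ Φ₂ _ fun a => by rw [hΦ₂]; exact hfil₂ a)
    ⟨TateModule.toRational p a₁, by rwa [hΦ₁]⟩ ⟨TateModule.toRational p a₂, by rwa [hΦ₂]⟩
  exact hm (apply_mem_of_forall_toRational_mem _ Φ₁ _ (fun a => by rw [hΦ₁]; exact hall a) m)

end Generic

/-- **Hodge–Tate nonvanishing for `V_pW|_{Γ_F}`** (`W` elliptic over `K₀ ⊆ F`, `char K₀ = 0`): two additive `ℤ_p`-homogeneous maps
`φ₁ φ₂ : T_pW →+ B_dR(F)`, `Γ_F`-equivariant through `absGaloisRestrict K₀ F`, with `φ₁ ⊆ Fil¹`, `φ₁ ≢ 0`, `φ₂ ⊆ B_dR⁺`, `φ₂ ⊄ Fil¹`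
(intended: `∫ω`, `∫η` through a matching `T_pW ≅ T_pŴ(𝒪_ℂ)`) ⟹ **`φ₁(a) ∉ Fil² B_dR` for some `a`**. The determinant hypothesis is
discharged by the Weil pairing (`det_restrictedRationalTateRep_eq_cyclotomicCharacter`). [cite: Tate1967, §4 Cor. 2]
[cite: Fontaine1982FormesDifferentielles, §5] [cite: SilvermanAEC2009, Prop. III.8.3] -/
theorem exists_not_mem_fil_two_restrictedRationalTateRep_of_periodHoms {K₀ : Type} [Field K₀] [CharZero K₀]
    (W : WeierstrassCurve K₀) [W.IsElliptic] [Algebra K₀ F]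
    (φ₁ φ₂ : W.tateModule p →+ (bdRPeriodRingData (F := F) (p := p) hp).B)
    (hφ₁ : ∀ (c : ℤ_[p]) (a : W.tateModule p), φ₁ (c • a) = (c : ℚ_[p]) • φ₁ a)
    (hφ₂ : ∀ (c : ℤ_[p]) (a : W.tateModule p), φ₂ (c • a) = (c : ℚ_[p]) • φ₂ a)
    (hσ₁ : ∀ (σ : absoluteGaloisGroup F) (a : W.tateModule p), φ₁ (absGaloisRestrict K₀ F σ • a) = σ • φ₁ a)
    (hσ₂ : ∀ (σ : absoluteGaloisGroup F) (a : W.tateModule p), φ₂ (absGaloisRestrict K₀ F σ • a) = σ • φ₂ a)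
    (hfil₁ : ∀ a, φ₁ a ∈ (bdRPeriodRingData (F := F) (p := p) hp).fil 1)
    (hfil₂ : ∀ a, φ₂ a ∈ (bdRPeriodRingData (F := F) (p := p) hp).fil 0)
    (hne : ∃ a, φ₁ a ≠ 0) (hnot : ∃ a, φ₂ a ∉ (bdRPeriodRingData (F := F) (p := p) hp).fil 1) :
    ∃ a, φ₁ a ∉ (bdRPeriodRingData (F := F) (p := p) hp).fil 2 := by
  have hpK : (p : K₀) ≠ 0 := Nat.cast_ne_zero.mpr (Fact.out : p.Prime).ne_zero
  haveI : Module.Finite ℚ_[p] (W.rationalTateModule p) := module_finite_rationalTateModule_holds W p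
  exact exists_not_mem_fil_two_rationalTateModule_of_periodHoms hp (restrictedRationalTateRep W F p)
    (fun σ a => absGaloisRestrict K₀ F σ • a) (finrank_rationalTateModule_eq_two_holds W p hpK) (fun _ _ _ => rfl)
    (det_restrictedRationalTateRep_eq_cyclotomicCharacter (F := F) (p := p) W) φ₁ φ₂ hφ₁ hφ₂ hσ₁ hσ₂ hfil₁ hfil₂ hne hnot

/-- **The basis-free `Fil⁰`-coboundary criterion with the Hodge–Tate hypothesis DISCHARGED.** As
`isFilZeroCoboundary_restrictedRationalTateRep_of_periodHoms`, but with `∃ a, φ₁ a ∉ Fil²` replaced by `∃ a, φ₁ a ≠ 0`: a map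
`η : Γ_F → T_pW` whose two periods are integrated (`φ₁(η σ) = σb₁ − b₁`, `b₁ ∈ Fil¹`; `φ₂(η σ) = σb₂ − b₂`, `b₂ ∈ B_dR⁺`) gives a
`Fil⁰`-coboundary `σ ↦ 1 ⊗ η(σ)` of `B_dR(F) ⊗ V_pW|_{Γ_F}`. [cite: BlochKato1990, Ex. 3.10.1, (3.11.1), Lemma 3.8.1]
[cite: Tate1967, §3.3 Thm. 2, §4 Cor. 2] -/
theorem isFilZeroCoboundary_restrictedRationalTateRep_of_periodHoms_of_ne_zero {K₀ : Type} [Field K₀] [CharZero K₀]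
    (W : WeierstrassCurve K₀) [W.IsElliptic] [Algebra K₀ F]
    (φ₁ φ₂ : W.tateModule p →+ (bdRPeriodRingData (F := F) (p := p) hp).B)
    (hφ₁ : ∀ (c : ℤ_[p]) (a : W.tateModule p), φ₁ (c • a) = (c : ℚ_[p]) • φ₁ a)
    (hφ₂ : ∀ (c : ℤ_[p]) (a : W.tateModule p), φ₂ (c • a) = (c : ℚ_[p]) • φ₂ a)
    (hσ₁ : ∀ (σ : absoluteGaloisGroup F) (a : W.tateModule p), φ₁ (absGaloisRestrict K₀ F σ • a) = σ • φ₁ a)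
    (hσ₂ : ∀ (σ : absoluteGaloisGroup F) (a : W.tateModule p), φ₂ (absGaloisRestrict K₀ F σ • a) = σ • φ₂ a)
    (hfil₁ : ∀ a, φ₁ a ∈ (bdRPeriodRingData (F := F) (p := p) hp).fil 1)
    (hfil₂ : ∀ a, φ₂ a ∈ (bdRPeriodRingData (F := F) (p := p) hp).fil 0)
    (hne : ∃ a, φ₁ a ≠ 0) (hnot : ∃ a, φ₂ a ∉ (bdRPeriodRingData (F := F) (p := p) hp).fil 1)
    (η : absoluteGaloisGroup F → W.tateModule p) {b₁ b₂ : (bdRPeriodRingData (F := F) (p := p) hp).B}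
    (hb₁ : b₁ ∈ (bdRPeriodRingData (F := F) (p := p) hp).fil 1) (hb₂ : b₂ ∈ (bdRPeriodRingData (F := F) (p := p) hp).fil 0)
    (hη₁ : ∀ σ, φ₁ (η σ) = σ • b₁ - b₁) (hη₂ : ∀ σ, φ₂ (η σ) = σ • b₂ - b₂) :
    (bdRPeriodRingData (F := F) (p := p) hp).IsFilZeroCoboundary (restrictedRationalTateRep W F p) fun σ =>
      ((1 : (bdRPeriodRingData (F := F) (p := p) hp).B) ⊗ₜ[ℚ_[p]] TateModule.toRational p (η σ) :
        (bdRPeriodRingData (F := F) (p := p) hp).B ⊗[ℚ_[p]] W.rationalTateModule p) :=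
  isFilZeroCoboundary_restrictedRationalTateRep_of_periodHoms hp W φ₁ φ₂ hφ₁ hφ₂ hσ₁ hσ₂ hfil₁ hfil₂
    (exists_not_mem_fil_two_restrictedRationalTateRep_of_periodHoms hp W φ₁ φ₂ hφ₁ hφ₂ hσ₁ hσ₂ hfil₁ hfil₂ hne hnot)
    hnot η hb₁ hb₂ hη₁ hη₂

end Literature.NumberTheory.PAdicHodge

end
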